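import Mathlib
import Literature.MathematicalPhysics.QuantumFieldTheory.Luscher2010.TrivializingMaps
import Literature.MathematicalPhysics.QuantumFieldTheory.Luscher2010.FlowActionSeries
import Summits.Ventures.LatticeQCDFlow.TrivializingMaps.LinkTransport
import Summits.Ventures.LatticeQCDFlow.TrivializingMaps.GaugeInvariantSeries
import HarnessLib

/-!
# Lattice symmetries of Lüscher series: link permutations and translations

HONEST FRAMING: exact (Metropolis-corrected) sampling algorithms for lattice gauge theory; figures of merit are
autocorrelation/cost numbers at stated couplings and volumes; no continuum-physics claim.

Lüscher, CMP 293 (2010) 899, §4.3–§4.4: the flow actions `S̃^{(k)}` are sums "over all possible positions of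
the loops on the lattice" — translation invariant like the action. With the uniqueness of the Haar-normalised
series (`NormalisedSeries`) this becomes a theorem for EVERY smooth solution of the recursion, and for every
symmetry of the action that permutes the links: if `σ : E ≃ E` and `S(W ∘ σ) = S(W)`, then
`S̃^{(k)}(ι(U ∘ σ)) = S̃^{(k)}(ιU)` on `SU(n)^E`.

* §1 `IsLuscherSeries.pushFun_equiv`: `(S̃^{(k)} ∘ σ^*, Ċ^{(k)})` solves the recursion again (tree
  `LinkTransport`: `∂` and `Δ` commute with link re-indexing); `IsHaarNormalised.pushFun_equiv` (`D[U]` is a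
  product of identical factors, Mathlib `measurePreserving_piCongrLeft`); `IsLuscherSeries.comp_equiv_eq`:
  invariance of every smooth solution on `SU(n)^E`; `IsLuscherSeries.linkDeriv_equiv`: covariance of the
  gradients (the flow generator), `∂_{σe} S̃^{(k)}(ιU) = ∂_e S̃^{(k)}(ι(U ∘ σ))`.
* §2 translations `translateLinks a : (x,μ) ↦ (x+a,μ)`: loop actions and the plaquette action are translation
  invariant (`loopAction_pullCfg_translate`, `ambWilsonAction_pullCfg_translate`), hence so is every smooth
  Lüscher series of them (`IsLuscherSeries.translate_eq_of_loopAction`, `…_of_smul_ambWilsonAction`), in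
  particular `wilsonSk` and `loopSk`, and their generators are translation covariant.

References: M. Lüscher, CMP 293 (2010) 899 [Luscher2010Trivializing, arXiv:0907.5491], §4.3 eqs. (4.12)–(4.15),
§4.4 eq. (4.19) ("the sums … extend over all possible positions of the loops").
-/

namespace Summit.Ventures.LatticeQCDFlow.TrivializingMaps

open MeasureTheory
open Literature.MathematicalPhysics.QuantumFieldTheory
open Literature.MathematicalPhysics.QuantumFieldTheory.Luscher2010
open scoped Matrix Matrix.Norms.Frobenius ContDiff

noncomputable section

variable {d L n : ℕ}

/-! ## §1. Link permutations that preserve the action -/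

section Perm

variable [NeZero L]

/-- Re-indexing configurations along a link map is smooth (it is linear). [folklore] -/
theorem contDiff_pullCfg (σ : Edge d L → Edge d L) : ContDiff ℝ ∞ (pullCfg (n := n) σ) := by
  have h : ∀ e : Edge d L, ContDiff ℝ ∞ fun V : AmbConfig d L n => V (σ e) :=
    fun e => WilsonFlow.contDiff_eval (σ e)
  exact contDiff_pi.2 h

omit [NeZero L] in
/-- Every functional depends only on the set of all links. [folklore] -/
theorem mem_depOn_univ (u : AmbConfig d L n → ℝ) : u ∈ depOn (Set.univ : Set (Edge d L)) :=
  fun _ _ h => congrArg u (funext fun i => h i (Set.mem_univ i))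

/-- **`D[U]` is invariant under link permutations** (`U ↦ U ∘ σ`). [cite: Luscher2010Trivializing, §2.1 eq. (2.1)] -/
theorem measurePreserving_comp_equiv (σ : Edge d L ≃ Edge d L) :
    MeasurePreserving (fun U : GaugeConfig d L (Matrix.specialUnitaryGroup (Fin n) ℂ) => fun e => U (σ e))
      (trivialMeasure (Matrix.specialUnitaryGroup (Fin n) ℂ) d L)
      (trivialMeasure (Matrix.specialUnitaryGroup (Fin n) ℂ) d L) := by
  have h := (measurePreserving_piCongrLeft
    (μ := fun _ : Edge d L => haarProbability (Matrix.specialUnitaryGroup (Fin n) ℂ)) σ).symm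
    (MeasurableEquiv.piCongrLeft (fun _ : Edge d L => Matrix.specialUnitaryGroup (Fin n) ℂ) σ)
  have hfun : ⇑((MeasurableEquiv.piCongrLeft (fun _ : Edge d L => ↥(Matrix.specialUnitaryGroup (Fin n) ℂ)) σ).symm) =
      fun U : GaugeConfig d L (Matrix.specialUnitaryGroup (Fin n) ℂ) => fun e => U (σ e) := by
    funext U e
    exact Equiv.piCongrLeft_symm_apply _ _ U e
  rw [hfun] at h
  exact h

/-- **A link permutation preserving the action maps Lüscher series to Lüscher series**:
`(S̃^{(k)} ∘ σ^*, Ċ^{(k)})` solves (4.12)–(4.15) again. [cite: Luscher2010Trivializing, §4.3 eqs. (4.12)–(4.15)] -/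
theorem IsLuscherSeries.pushFun_equiv {B : SuBasis n} {S : AmbConfig d L n → ℝ} {Sk : ℕ → AmbConfig d L n → ℝ}
    {c : ℕ → ℝ} (h : IsLuscherSeries B S Sk c) (σ : Edge d L ≃ Edge d L)
    (hS : ∀ W : AmbConfig d L n, S (pullCfg σ W) = S W) :
    IsLuscherSeries B S (fun k => pushFun σ (Sk k)) c := by
  have hτ : ∀ e ∈ (Set.univ : Set (Edge d L)), ∀ e₂, σ e₂ = σ e → e₂ = e :=
    fun e _ e₂ he => σ.injective he
  have hSfun : pushFun σ S = S := funext fun W => hS W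
  refine ⟨fun U => ?_, fun k U => ?_⟩
  · rw [linkLap_pushFun B σ hτ (mem_depOn_univ (Sk 0)), pullCfg_coeConfig, h.1, ← pullCfg_coeConfig, hS]
  · rw [linkLap_pushFun B σ hτ (mem_depOn_univ (Sk (k + 1))), pullCfg_coeConfig, h.2 k]
    congr 2
    conv_rhs => rw [← Equiv.sum_comp σ]
    refine Finset.sum_congr rfl fun e _ => Finset.sum_congr rfl fun a _ => ?_
    show _ = linkDeriv (σ e) (B.T a) S (WilsonFlow.coeConfig U) *
      linkDeriv (σ e) (B.T a) (pushFun σ (Sk k)) (WilsonFlow.coeConfig U)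
    rw [linkDeriv_pushFun σ (hτ e (Set.mem_univ e)) (B.T a) (Sk k), pullCfg_coeConfig]
    congr 1
    conv_rhs => rw [← hSfun]
    rw [linkDeriv_pushFun σ (hτ e (Set.mem_univ e)), pullCfg_coeConfig]

/-- The re-indexed series is smooth. [folklore] -/
theorem contDiff_pushFun {u : AmbConfig d L n → ℝ} (hu : ContDiff ℝ ∞ u) (σ : Edge d L → Edge d L) :
    ContDiff ℝ ∞ (pushFun σ u) :=
  hu.comp (contDiff_pullCfg σ)

/-- Re-indexing preserves App. E's normalisation. [cite: Luscher2010Trivializing, App. E.2] -/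
theorem IsHaarNormalised.pushFun_equiv {Sk : ℕ → AmbConfig d L n → ℝ} (hN : IsHaarNormalised Sk)
    (hsm : ∀ k, ContDiff ℝ ∞ (Sk k)) (σ : Edge d L ≃ Edge d L) :
    IsHaarNormalised (fun k => pushFun σ (Sk k)) := by
  intro k
  have hmp := measurePreserving_comp_equiv (d := d) (L := L) (n := n) σ
  have hF : AEStronglyMeasurable
      (fun U : GaugeConfig d L (Matrix.specialUnitaryGroup (Fin n) ℂ) => Sk k (WilsonFlow.coeConfig U))
      (Measure.map (fun U : GaugeConfig d L (Matrix.specialUnitaryGroup (Fin n) ℂ) => fun e => U (σ e))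
        (trivialMeasure (Matrix.specialUnitaryGroup (Fin n) ℂ) d L)) := by
    rw [hmp.map_eq]
    exact ((hsm k).continuous.comp WilsonFlow.continuous_coeConfig).aestronglyMeasurable
  show ∫ U, pushFun σ (Sk k) (WilsonFlow.coeConfig U) ∂(trivialMeasure (Matrix.specialUnitaryGroup (Fin n) ℂ) d L) = 0
  simp_rw [pushFun_apply, pullCfg_coeConfig]
  rw [← integral_map hmp.measurable.aemeasurable hF, hmp.map_eq]
  exact hN k

/-- **Every smooth Lüscher series of a `σ`-invariant action is `σ`-invariant on `SU(n)^E`**: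
`S̃^{(k)}(ι(U ∘ σ)) = S̃^{(k)}(ιU)` (uniqueness of the normalised series; any normalisation, by subtracting
Haar means). [cite: Luscher2010Trivializing, §4.3] -/
theorem IsLuscherSeries.comp_equiv_eq {B : SuBasis n} {S : AmbConfig d L n → ℝ} {Sk : ℕ → AmbConfig d L n → ℝ}
    {c : ℕ → ℝ} (h : IsLuscherSeries B S Sk c) (hsm : ∀ k, ContDiff ℝ ∞ (Sk k)) (σ : Edge d L ≃ Edge d L)
    (hS : ∀ W : AmbConfig d L n, S (pullCfg σ W) = S W) (k : ℕ)
    (U : GaugeConfig d L (Matrix.specialUnitaryGroup (Fin n) ℂ)) :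
    Sk k (WilsonFlow.coeConfig fun e => U (σ e)) = Sk k (WilsonFlow.coeConfig U) := by
  obtain ⟨hL, hN, hsm'⟩ := IsLuscherSeries.sub_haarMean h hsm
  have huniq := IsLuscherSeries.coeConfig_eq_of_isHaarNormalised (IsLuscherSeries.pushFun_equiv hL σ hS) hL
    (fun k => contDiff_pushFun (hsm' k) σ) hsm' (IsHaarNormalised.pushFun_equiv hN hsm' σ) hN k U
  rw [pushFun_apply, pullCfg_coeConfig] at huniq
  have huniq' : Sk k (WilsonFlow.coeConfig fun e => U (σ e)) - haarMean (Sk k) =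
      Sk k (WilsonFlow.coeConfig U) - haarMean (Sk k) := huniq
  linarith

/-- **Covariance of the gradients** (the flow generator): `∂_{σe,Y} S̃^{(k)}(ιU) = ∂_{e,Y} S̃^{(k)}(ι(U ∘ σ))`
for `Y ∈ 𝔰𝔲(n)`. [cite: Luscher2010Trivializing, §4.2 eq. (4.4), §4.3] -/
theorem IsLuscherSeries.linkDeriv_equiv {B : SuBasis n} {S : AmbConfig d L n → ℝ} {Sk : ℕ → AmbConfig d L n → ℝ}
    {c : ℕ → ℝ} (h : IsLuscherSeries B S Sk c) (hsm : ∀ k, ContDiff ℝ ∞ (Sk k)) (σ : Edge d L ≃ Edge d L)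
    (hS : ∀ W : AmbConfig d L n, S (pullCfg σ W) = S W) (k : ℕ) (e : Edge d L)
    {Y : Matrix (Fin n) (Fin n) ℂ} (hY : Y ∈ suAlgebra n)
    (U : GaugeConfig d L (Matrix.specialUnitaryGroup (Fin n) ℂ)) :
    linkDeriv (σ e) Y (Sk k) (WilsonFlow.coeConfig U) =
      linkDeriv e Y (Sk k) (WilsonFlow.coeConfig fun e' => U (σ e')) := by
  have hinv : ∀ U' : GaugeConfig d L (Matrix.specialUnitaryGroup (Fin n) ℂ),
      pushFun σ (Sk k) (WilsonFlow.coeConfig U') = Sk k (WilsonFlow.coeConfig U') := fun U' => by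
    rw [pushFun_apply, pullCfg_coeConfig]
    exact IsLuscherSeries.comp_equiv_eq h hsm σ hS k U'
  rw [← linkDeriv_coeConfig_congr hinv (σ e) hY U, linkDeriv_pushFun σ (fun e₂ he => σ.injective he),
    pullCfg_coeConfig]

end Perm

/-! ## §2. Translations -/

/-- Translation of the links by a lattice vector: `(x, μ) ↦ (x + a, μ)`. [folklore] -/
def translateLinks (a : Site d L) : Edge d L ≃ Edge d L :=
  Equiv.prodCongr (Equiv.addRight a) (Equiv.refl (Fin d))

/-- Unfolding `translateLinks`. [folklore] -/
@[simp] theorem translateLinks_apply (a x : Site d L) (μ : Fin d) : translateLinks a (x, μ) = (x + a, μ) := rfl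

/-- Translated configurations have translated loop products: `U(C_x)[W ∘ τ_a] = U(C_{x+a})[W]`.
[cite: Luscher2010Trivializing, §4.4 eq. (4.19)] -/
theorem pathProd_pullCfg_translate (a : Site d L) (W : AmbConfig d L n) :
    ∀ (w : PathWord d) (x : Site d L), pathProd (pullCfg (translateLinks a) W) x w = pathProd W (x + a) w
  | [], x => rfl
  | (μ, true) :: w, x => by
      have hs : x.shift μ + a = (x + a).shift μ := by simp only [Site.shift]; abel
      rw [pathProd_cons_true, pathProd_cons_true, pathProd_pullCfg_translate a W w, pullCfg_apply,
        translateLinks_apply, hs]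
  | (μ, false) :: w, x => by
      have hs : x - Pi.single μ 1 + a = x + a - Pi.single μ 1 := by abel
      rw [pathProd_cons_false, pathProd_cons_false, pathProd_pullCfg_translate a W w, pullCfg_apply,
        translateLinks_apply, hs]

variable [NeZero L]

/-- **Loop actions are translation invariant**: `S(W ∘ τ_a) = S(W)` ("the sums … extend over all possible
positions of the loops on the lattice"). [cite: Luscher2010Trivializing, §4.4 eq. (4.19)] -/
theorem loopAction_pullCfg_translate (shapes : Finset (PathWord d)) (coef : PathWord d → ℂ) (a : Site d L)
    (W : AmbConfig d L n) : loopAction shapes coef (pullCfg (translateLinks a) W) = loopAction shapes coef W := by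
  unfold loopAction
  simp_rw [pathProd_pullCfg_translate]
  exact Equiv.sum_comp (Equiv.addRight a) (fun x => ∑ w ∈ shapes, (coef w * (pathProd W x w).trace).re)

/-- **The plaquette action is translation invariant.** [cite: Luscher2010Trivializing, §4.4 eq. (4.16)] -/
theorem ambWilsonAction_pullCfg_translate (a : Site d L) (W : AmbConfig d L n) :
    ambWilsonAction (pullCfg (translateLinks a) W) = ambWilsonAction W := by
  unfold ambWilsonAction
  have hs : ∀ (x : Site d L) (μ : Fin d), x.shift μ + a = (x + a).shift μ := fun x μ => by
    simp only [Site.shift]; abel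
  simp only [pullCfg_apply, translateLinks_apply, hs]
  exact Equiv.sum_comp (Equiv.addRight a) (fun x => ∑ μ : Fin d, ∑ ν : Fin d,
    if μ < ν then ((1 : Matrix (Fin n) (Fin n) ℂ) -
      W (x, μ) * W (x.shift μ, ν) * (W (x.shift ν, μ))ᴴ * (W (x, ν))ᴴ).trace.re else 0)

/-- **Every smooth Lüscher series of a loop action is translation invariant on `SU(n)^E`.**
[cite: Luscher2010Trivializing, §4.3–§4.4] -/
theorem IsLuscherSeries.translate_eq_of_loopAction {B : SuBasis n} {shapes : Finset (PathWord d)}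
    {coef : PathWord d → ℂ} {Sk : ℕ → AmbConfig d L n → ℝ} {c : ℕ → ℝ}
    (h : IsLuscherSeries B (loopAction shapes coef) Sk c) (hsm : ∀ k, ContDiff ℝ ∞ (Sk k)) (a : Site d L)
    (k : ℕ) (U : GaugeConfig d L (Matrix.specialUnitaryGroup (Fin n) ℂ)) :
    Sk k (WilsonFlow.coeConfig fun e => U (translateLinks a e)) = Sk k (WilsonFlow.coeConfig U) :=
  IsLuscherSeries.comp_equiv_eq h hsm (translateLinks a) (loopAction_pullCfg_translate shapes coef a) k U

/-- **Every smooth Lüscher series of `β S_W` is translation invariant on `SU(n)^E`.**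
[cite: Luscher2010Trivializing, §4.3–§4.4] -/
theorem IsLuscherSeries.translate_eq_of_smul_ambWilsonAction {B : SuBasis n} (β : ℝ)
    {Sk : ℕ → AmbConfig d L n → ℝ} {c : ℕ → ℝ}
    (h : IsLuscherSeries B (fun W : AmbConfig d L n => β * ambWilsonAction W) Sk c)
    (hsm : ∀ k, ContDiff ℝ ∞ (Sk k)) (a : Site d L) (k : ℕ)
    (U : GaugeConfig d L (Matrix.specialUnitaryGroup (Fin n) ℂ)) :
    Sk k (WilsonFlow.coeConfig fun e => U (translateLinks a e)) = Sk k (WilsonFlow.coeConfig U) :=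
  IsLuscherSeries.comp_equiv_eq h hsm (translateLinks a)
    (fun W => by simp only [ambWilsonAction_pullCfg_translate]) k U

/-- The tree's constructed Wilson series `wilsonSk` is translation invariant on `SU(n)^E`. [folklore] -/
theorem wilsonSk_translate (B : SuBasis n) (a : Site d L) (k : ℕ)
    (U : GaugeConfig d L (Matrix.specialUnitaryGroup (Fin n) ℂ)) :
    wilsonSk d L B k (WilsonFlow.coeConfig fun e => U (translateLinks a e)) =
      wilsonSk d L B k (WilsonFlow.coeConfig U) :=
  IsLuscherSeries.comp_equiv_eq (isLuscherSeries_wilsonSk B) (contDiff_wilsonSk B) (translateLinks a)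
    (ambWilsonAction_pullCfg_translate a) k U

/-- The constructed loop-action series `loopSk` is translation invariant on `SU(n)^E` (`d ≥ 2`; its
site-anchored construction is not manifestly so). [folklore] -/
theorem loopSk_translate (hd : 2 ≤ d) (B : SuBasis n) (shapes : Finset (PathWord d)) (coef : PathWord d → ℂ)
    (ν₀ : Fin d) (a : Site d L) (k : ℕ) (U : GaugeConfig d L (Matrix.specialUnitaryGroup (Fin n) ℂ)) :
    loopSk hd B shapes coef ν₀ L k (WilsonFlow.coeConfig fun e => U (translateLinks a e)) =
      loopSk hd B shapes coef ν₀ L k (WilsonFlow.coeConfig U) :=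
  IsLuscherSeries.comp_equiv_eq (isLuscherSeries_loopSk hd B shapes coef ν₀ L)
    (contDiff_loopSk hd B shapes coef ν₀ L) (translateLinks a) (loopAction_pullCfg_translate shapes coef a) k U

/-- **Translation covariance of the flow generator of `β S_W`**: for every smooth Lüscher series,
`∂_{(x+a,μ),Y} S̃^{(k)}(ιU) = ∂_{(x,μ),Y} S̃^{(k)}(ι(U ∘ τ_a))`, `Y ∈ 𝔰𝔲(n)`.
[cite: Luscher2010Trivializing, §4.2 eq. (4.4), §4.3] -/
theorem IsLuscherSeries.linkDeriv_translate_of_smul_ambWilsonAction {B : SuBasis n} (β : ℝ)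
    {Sk : ℕ → AmbConfig d L n → ℝ} {c : ℕ → ℝ}
    (h : IsLuscherSeries B (fun W : AmbConfig d L n => β * ambWilsonAction W) Sk c)
    (hsm : ∀ k, ContDiff ℝ ∞ (Sk k)) (a x : Site d L) (μ : Fin d) (k : ℕ)
    {Y : Matrix (Fin n) (Fin n) ℂ} (hY : Y ∈ suAlgebra n)
    (U : GaugeConfig d L (Matrix.specialUnitaryGroup (Fin n) ℂ)) :
    linkDeriv (x + a, μ) Y (Sk k) (WilsonFlow.coeConfig U) =
      linkDeriv (x, μ) Y (Sk k) (WilsonFlow.coeConfig fun e => U (translateLinks a e)) :=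
  IsLuscherSeries.linkDeriv_equiv h hsm (translateLinks a)
    (fun W => by simp only [ambWilsonAction_pullCfg_translate]) k (x, μ) hY U

/-- Translation covariance of the flow generator of a loop action (every smooth Lüscher series).
[cite: Luscher2010Trivializing, §4.2 eq. (4.4), §4.3] -/
theorem IsLuscherSeries.linkDeriv_translate_of_loopAction {B : SuBasis n} {shapes : Finset (PathWord d)}
    {coef : PathWord d → ℂ} {Sk : ℕ → AmbConfig d L n → ℝ} {c : ℕ → ℝ}
    (h : IsLuscherSeries B (loopAction shapes coef) Sk c) (hsm : ∀ k, ContDiff ℝ ∞ (Sk k)) (a x : Site d L)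
    (μ : Fin d) (k : ℕ) {Y : Matrix (Fin n) (Fin n) ℂ} (hY : Y ∈ suAlgebra n)
    (U : GaugeConfig d L (Matrix.specialUnitaryGroup (Fin n) ℂ)) :
    linkDeriv (x + a, μ) Y (Sk k) (WilsonFlow.coeConfig U) =
      linkDeriv (x, μ) Y (Sk k) (WilsonFlow.coeConfig fun e => U (translateLinks a e)) :=
  IsLuscherSeries.linkDeriv_equiv h hsm (translateLinks a) (loopAction_pullCfg_translate shapes coef a) k
    (x, μ) hY U

end

end Summit.Ventures.LatticeQCDFlow.TrivializingMaps
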